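import Mathlib
import Summits.AnomalousDissipation.AnomalousDissipation.Theorems.ScalarAnomalySteadySourceFormal.Negative.HeatProfile
import Summits.AnomalousDissipation.AnomalousDissipation.Theorems.ScalarAnomalySteadySourceFormal.Negative.LoadBearing
import Literature.Analysis.FluidPDE.PassiveScalarClassicalEnergy
import Literature.Analysis.FluidPDE.TurbWave0

/-!
# `stub_meanSquareBodyFixedViscosity`: the body of S1'' holds at every FIXED viscosity

Honesty / load-bearing certificate for the reshaped residual S1'' (`stub_meanSquareMixerRealizable`)
of the line `budgeted-mixer-template` (reshape r2, lead c2) for the crux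
`Summit.AnomalousDissipation.AnomalousDissipation.Theses.TwoAndHalfD.ScalarAnomalySteadySourceFormal`
(stmt-AnomalousDissipation-0448); the statement is registered verbatim on the item.

CONTENT.  S1'' asks for ONE smooth divergence-free mean-zero steady planar force `g`, ONE smooth
mean-zero profile `h`, viscosities `ν_j → 0`, classical Navier–Stokes solutions `(v_j, p_j)` forced
by `g` on `[0, ∞)` with pointwise energy bound `E`, the classical releases `φ_j s` of `h` at every
`s ≥ 0` (unforced unit-Prandtl advection–diffusion over `v_j` on `[s, ∞)`), an antitone rate `m > 0`
with `∫₀ᵗ m ≤ M`, and the two statistical clauses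
* (MS) `∫_{s₀}^{T} ‖φ_j s (s+τ)‖² ds ≤ (B + (T − s₀))·m(τ)²‖h‖²` (`τ ≥ 0`, `T ≥ s₀`),
* (GK) `0 < ε ≤ liminf_T T⁻¹∫₀ᵀ ∫₀ᵗ (h, φ_j s (t)) ds dt`.
THIS FILE proves that the same clause set WITH THE VISCOSITY FROZEN at an arbitrary `ν > 0` (and the
extra honesty clause `‖h‖² ≠ 0`) is satisfied — by the flow AT REST (`g = 0`, `v_j = 0`, `p_j = 0`,
`E = 0`) and the heat releases of one Laplace eigenfunction: `h = cos(2πx₁)` (`cosMode k₁ 1`,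
`λ := λ_{k₁} = 4π²`), `φ_j s (t) = e^{-νλ(t-s)} h`, rate `m(τ) = e^{-νλτ}` (`M = 1/(νλ)`, `s₀ = B = 0`),
for which (MS) is an identity (`‖φ_j s (s+τ)‖² = e^{-2νλτ}‖h‖²` for every `s`) and the Green–Kubo
means converge: `∫₀ᵗ (h, φ_j s (t)) ds = (1 − e^{−νλt})/(2νλ)`, whose Cesàro means tend to
`ε := 1/(2νλ)`.  Consequences for planners / the disprover: (i) the clause set of S1'' is CONSISTENT as
typed (no accidental falsity in the bookkeeping of `s₀, B, M, m, ε`, the one-sided time derivatives,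
or the release normalisation `φ_j s s = h`); (ii) the vanishing-viscosity clause `ν_j → 0` is the ONLY
load-bearing asymptotic of S1'' — every refutation must use it quantitatively (here `ε = 1/(8π²ν)`,
`M = 1/(4π²ν)` blow up exactly as `ν → 0`, in accordance with the rest-flow no-go
`Negative.restFlow_not_anomalous`).  Mirrors `Negative.cruxWithoutVarianceBound_holds` /
`cruxWithoutFloor_holds` (LoadBearing) and reuses the one-mode calculus of `Negative/HeatProfile`
(`cosMode`, `laplacian_cosMode`, `scalarL2Sq_cosMode`, `integral_cosMode_one_sq`).

PROOF.  Elementary: the heat release `e^{-νλ(t-s)} cos(2πk₁·x)` is jointly smooth (product of a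
smooth function of `t` and of `x`), solves `∂ₜθ = νΔθ` classically on `[s, ∞)` (one-sided derivative
`HasDerivAt.derivWithin`, `Δ cosMode = -λ cosMode`), `∫₀ᵗ e^{-cτ} dτ = (1 - e^{-ct})/c ≤ 1/c`,
`∫₀ᵀ (1 - e^{-ct})/(2c) dt = (T − (1 − e^{−cT})/c)/(2c)` and `T⁻¹` times it tends to `1/(2c)`
(`Filter.Tendsto.liminf_eq`).  Supports stmt-AnomalousDissipation-0448.
[folklore: heat semigroup on one Fourier mode; Doering–Foias 2002, §2 (time means)]
-/

noncomputable section

-- the summit path `AnomalousDissipation/AnomalousDissipation` duplicates a namespace component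
set_option linter.dupNamespace false

namespace Summit.AnomalousDissipation.AnomalousDissipation.Theorems.ScalarAnomalySteadySourceFormal.MeanSquareBodyFixedViscosity

open MeasureTheory Set Filter Topology
open scoped ContDiff InnerProductSpace
open Literature.Analysis
open Literature.Analysis.FunctionSpaces Literature.Analysis.FunctionSpaces.Torus
open Literature.Analysis.FluidPDE Literature.Analysis.FluidPDE.Torus
open Summit.AnomalousDissipation.AnomalousDissipation.Theorems.ScalarAnomalySteadySourceFormal.Negative

/-! ## Real-variable lemmas: the exponential rate `e^{-cτ}` -/

/-- `∫₀ᵗ e^{-cτ} dτ = (1 - e^{-ct})/c` for `c ≠ 0`: Mathlib's `integral_exp` after the substitution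
`intervalIntegral.integral_comp_mul_left` (cf. the twins `BourgainPavlovic.SignalScalar.integral_exp_neg_eq`,
`LiSinai.integral_exp_neg_sub_mul` in unrelated Literature files, not imported here). [folklore] -/
theorem heatRate_integral_eq {c : ℝ} (hc : c ≠ 0) (t : ℝ) :
    ∫ τ in (0 : ℝ)..t, Real.exp (-c * τ) = (1 - Real.exp (-c * t)) / c := by
  rw [intervalIntegral.integral_comp_mul_left Real.exp (neg_ne_zero.2 hc), integral_exp, mul_zero,
    Real.exp_zero, smul_eq_mul, inv_mul_eq_div, ← neg_div_neg_eq, neg_sub, neg_neg]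

/-- `∫₀ᵗ e^{-cτ} dτ ≤ 1/c` for `c > 0` (every `t`; cf. `FourierNS.integral_exp_neg_mul_sub_le`). [folklore] -/
theorem heatRate_integral_le {c : ℝ} (hc : 0 < c) (t : ℝ) :
    ∫ τ in (0 : ℝ)..t, Real.exp (-c * τ) ≤ 1 / c := by
  rw [heatRate_integral_eq hc.ne']
  exact div_le_div_of_nonneg_right (by linarith [Real.exp_pos (-c * t)]) hc.le

/-- The rate `τ ↦ e^{-cτ}` is antitone for `c ≥ 0`. [folklore] -/
theorem heatRate_antitone {c : ℝ} (hc : 0 ≤ c) : Antitone fun τ : ℝ => Real.exp (-c * τ) :=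
  fun _ _ hab => Real.exp_le_exp.2 (mul_le_mul_of_nonpos_left hab (neg_nonpos.2 hc))

/-- `∫₀ᵀ (1 - e^{-ct})/(2c) dt = (T - (1 - e^{-cT})/c)/(2c)` for `c ≠ 0`. [folklore] -/
theorem heatRate_gk_integral_eq {c : ℝ} (hc : c ≠ 0) (T : ℝ) :
    ∫ t in (0 : ℝ)..T, (1 - Real.exp (-c * t)) / (2 * c) =
      (T - (1 - Real.exp (-c * T)) / c) / (2 * c) := by
  rw [intervalIntegral.integral_div, intervalIntegral.integral_sub intervalIntegrable_const
      ((by fun_prop : Continuous fun t : ℝ => Real.exp (-c * t)).intervalIntegrable 0 T),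
    intervalIntegral.integral_const, heatRate_integral_eq hc]
  simp only [smul_eq_mul, mul_one, sub_zero]

/-- The Cesàro means of `t ↦ (1 - e^{-ct})/(2c)` tend to `1/(2c)` (`c > 0`): for `T > 0` the mean is
`1/(2c) - T⁻¹(1 - e^{-cT})/(2c²)`. [folklore] -/
theorem tendsto_timeMean_heatRate_gk {c : ℝ} (hc : 0 < c) :
    Tendsto (timeMean fun t => (1 - Real.exp (-c * t)) / (2 * c)) atTop (𝓝 (1 / (2 * c))) := by
  have hexp : Tendsto (fun T : ℝ => Real.exp (-c * T)) atTop (𝓝 0) := by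
    have h := Real.tendsto_exp_neg_atTop_nhds_zero.comp (tendsto_id.const_mul_atTop hc)
    exact h.congr fun T => by simp [neg_mul]
  have h1 : Tendsto (fun T : ℝ => 1 - Real.exp (-c * T)) atTop (𝓝 (1 - 0)) :=
    tendsto_const_nhds.sub hexp
  have h2 : Tendsto (fun T : ℝ => T⁻¹ * (1 - Real.exp (-c * T))) atTop (𝓝 (0 * (1 - 0))) :=
    tendsto_inv_atTop_zero.mul h1
  have h3 := (h2.div_const (2 * c ^ 2)).const_sub (1 / (2 * c))
  have hval : 1 / (2 * c) - 0 * (1 - 0) / (2 * c ^ 2) = 1 / (2 * c) := by ring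
  rw [hval] at h3
  refine h3.congr' ?_
  filter_upwards [eventually_gt_atTop (0 : ℝ)] with T hT
  have hT' : T ≠ 0 := hT.ne'
  have hc' : c ≠ 0 := hc.ne'
  rw [timeMean, heatRate_gk_integral_eq hc' T]
  field_simp

/-! ## The flow at rest and the heat releases of one Laplace eigenfunction -/

/-- **The flow at rest is a classical Navier–Stokes solution** for the zero force, on every time set
(zero pressure, every viscosity; cf. `Negative.isClassicalNSSolutionOn_rest`, the case `univ`). [folklore] -/
theorem isClassicalNSSolutionOn_rest_on (S : Set ℝ) (ν : ℝ) :
    Torus.IsClassicalNSSolutionOn S ν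
      (fun (_ : ℝ) (_ : UnitAddTorus (Fin 2)) => (0 : EuclideanSpace ℝ (Fin 2)))
      (fun (_ : ℝ) (_ : UnitAddTorus (Fin 2)) => (0 : EuclideanSpace ℝ (Fin 2)))
      (fun (_ : ℝ) (_ : UnitAddTorus (Fin 2)) => (0 : ℝ)) where
  smooth_velocity := contDiffOn_const
  smooth_pressure := contDiffOn_const
  momentum := fun t _ x => by simp
  divFree := fun _ _ x => divergence_zero x

/-- `∫ cos(2πk₁·x) · (a cos(2πk₁·x)) dx = a/2` (`∫ cos² = 1/2`). [folklore] -/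
theorem integral_cosMode_one_mul_cosMode (a : ℝ) :
    ∫ x, cosMode k₁ 1 x * cosMode k₁ a x = a / 2 := by
  have h : ∀ x, cosMode k₁ 1 x * cosMode k₁ a x = a * cosMode k₁ 1 x ^ 2 := fun x => by
    simp only [cosMode_apply]
    ring
  simp_rw [h]
  rw [integral_const_mul, integral_cosMode_one_sq k₁_ne_zero]
  ring

/-- **The heat release of one mode is a classical (unforced) advection–diffusion solution over the
flow at rest**: `θ(t) = e^{-νλ_k (t-s)} cos(2πk·x)` solves `∂ₜθ + 0·∇θ = νΔθ` on `[s, ∞) × T²` with the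
ONE-SIDED time derivative within `Ici s` (`Δ cos(2πk·x) = -λ_k cos(2πk·x)`, `λ_k = 4π²|k|²`). [folklore] -/
theorem isClassicalScalarTransportOn_heatRelease (k : Fin 2 → ℤ) (ν s : ℝ) :
    IsClassicalScalarTransportOn (Ici s) ν
      (fun (_ : ℝ) (_ : UnitAddTorus (Fin 2)) => (0 : EuclideanSpace ℝ (Fin 2)))
      (fun t => cosMode k (Real.exp (-(ν * lam k) * (t - s)))) where
  smooth_velocity := contDiffOn_const
  smooth_scalar := by
    have hprod : (fun t => cosMode k (Real.exp (-(ν * lam k) * (t - s)))) =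
        fun t x => Real.exp (-(ν * lam k) * (t - s)) * cosMode k 1 x := by
      funext t x
      rw [cosMode_apply, cosMode_apply, one_mul]
    have hψ : ContDiff ℝ ∞ fun p : ℝ × EuclideanSpace ℝ (Fin 2) => Real.exp (-(ν * lam k) * (p.1 - s)) :=
      (contDiff_const.mul (contDiff_fst.sub contDiff_const)).exp
    rw [hprod]
    exact FunctionSpaces.Torus.IsSmoothSpaceTimeOn.mul
      (FunctionSpaces.Torus.isSmoothSpaceTimeOn_of_contDiff hψ _)
      (FunctionSpaces.Torus.isSmoothSpaceTimeOn_const (isSmooth_cosMode k 1) _)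
  transport := fun t ht x => by
    have hfun : (fun τ => cosMode k (Real.exp (-(ν * lam k) * (τ - s))) x) =
        fun τ => Real.exp (-(ν * lam k) * (τ - s)) * cosMode k 1 x := by
      funext τ
      rw [cosMode_apply, cosMode_apply, one_mul]
    have hderiv : HasDerivAt (fun τ => Real.exp (-(ν * lam k) * (τ - s)) * cosMode k 1 x)
        (Real.exp (-(ν * lam k) * (t - s)) * (-(ν * lam k) * 1) * cosMode k 1 x) t :=
      (((hasDerivAt_id' t).sub_const s).const_mul (-(ν * lam k))).exp.mul_const _
    have hd : FunctionSpaces.Torus.timeDerivWithin (Ici s)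
        (fun t => cosMode k (Real.exp (-(ν * lam k) * (t - s)))) t x =
        Real.exp (-(ν * lam k) * (t - s)) * (-(ν * lam k) * 1) * cosMode k 1 x := by
      show derivWithin (fun τ => cosMode k (Real.exp (-(ν * lam k) * (τ - s))) x) (Ici s) t = _
      rw [hfun]
      exact hderiv.hasDerivWithinAt.derivWithin (uniqueDiffOn_Ici s t ht)
    rw [hd, inner_zero_left, add_zero, laplacian_cosMode, ← lam]
    simp only [cosMode_apply]
    ring
  divFree := fun _ _ x => divergence_zero x

/-- **Green–Kubo integrand of the heat releases**: `∫₀ᵗ (cos(2πk₁·), e^{-c(t-s)} cos(2πk₁·)) ds =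
(1 - e^{-ct})/(2c)` for `c ≠ 0` (every `t`). [folklore] -/
theorem heatRelease_gk_integral_eq {c : ℝ} (hc : c ≠ 0) (t : ℝ) :
    ∫ s in (0 : ℝ)..t, ∫ x, cosMode k₁ 1 x * cosMode k₁ (Real.exp (-c * (t - s))) x =
      (1 - Real.exp (-c * t)) / (2 * c) := by
  simp_rw [integral_cosMode_one_mul_cosMode]
  have h := intervalIntegral.integral_comp_sub_left (a := 0) (b := t)
    (fun u => Real.exp (-c * u) / 2) t
  simp only [sub_self, sub_zero] at h
  rw [h, intervalIntegral.integral_div, heatRate_integral_eq hc]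
  ring

/-! ## The registered stub -/

/-- **Stub `stub_meanSquareBodyFixedViscosity` (honesty / load-bearing certificate for S1'').**
For every FIXED viscosity `ν > 0` the body of S1'' (`stub_meanSquareMixerRealizable` with the clause
`ν_j → 0` deleted, plus `‖h‖² ≠ 0`) is satisfied: `g = 0`, `h = cos(2πx₁)`, `v_j = 0`, `p_j = 0`,
`φ_j s (t) = e^{-4π²ν(t-s)} h`, `m(τ) = e^{-4π²ντ}`, `E = s₀ = B = 0`, `M = 1/(4π²ν)`,
`ε = 1/(8π²ν)`.  Hence the clause set of S1'' is consistent as typed and `Tendsto ν atTop (𝓝 0)` is its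
only load-bearing asymptotic. [folklore] -/
theorem stub_meanSquareBodyFixedViscosity :
    ∀ ν : ℝ, 0 < ν →
    ∃ (g : UnitAddTorus (Fin 2) → EuclideanSpace ℝ (Fin 2)) (h : UnitAddTorus (Fin 2) → ℝ),
      Torus.IsSmooth g ∧ Torus.IsDivFree g ∧ Torus.HasZeroMean g ∧ Torus.IsSmooth h ∧ Torus.HasZeroMean h ∧
      Torus.scalarL2Sq h ≠ 0 ∧
      ∃ (v : ℕ → ℝ → UnitAddTorus (Fin 2) → EuclideanSpace ℝ (Fin 2))
        (p : ℕ → ℝ → UnitAddTorus (Fin 2) → ℝ) (φ : ℕ → ℝ → ℝ → UnitAddTorus (Fin 2) → ℝ)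
        (m : ℝ → ℝ) (E s₀ B M ε : ℝ),
        (∀ j, Torus.IsClassicalNSSolutionOn (Set.Ici 0) ν (fun _ => g) (v j) (p j)) ∧
        (∀ j t, 0 ≤ t → ∫ x, ‖v j t x‖ ^ 2 ≤ E) ∧
        (∀ j s, 0 ≤ s → Torus.IsClassicalScalarTransportOn (Set.Ici s) ν (v j) (φ j s) ∧ φ j s s = h) ∧
        0 ≤ s₀ ∧ 0 ≤ B ∧ Antitone m ∧ (∀ τ, 0 < m τ) ∧ (∀ t, 0 ≤ t → ∫ τ in (0 : ℝ)..t, m τ ≤ M) ∧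
        (∀ j τ T, 0 ≤ τ → s₀ ≤ T →
          ∫ s in s₀..T, Torus.scalarL2Sq (φ j s (s + τ)) ≤ (B + (T - s₀)) * m τ ^ 2 * Torus.scalarL2Sq h) ∧
        0 < ε ∧
        (∀ j, ε ≤ liminf (timeMean fun t => ∫ s in (0 : ℝ)..t, ∫ x, h x * φ j s t x) atTop) := by
  intro ν hν
  have hl : 0 < lam k₁ := lam_k₁_pos
  have hc : 0 < ν * lam k₁ := mul_pos hν hl
  -- `‖h‖² = 1/2 ≠ 0`
  have hh0 : Torus.scalarL2Sq (cosMode k₁ 1) ≠ 0 := by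
    rw [scalarL2Sq_cosMode k₁_ne_zero]
    norm_num
  -- the flow at rest
  have hNS : ∀ j : ℕ, Torus.IsClassicalNSSolutionOn (Set.Ici (0 : ℝ)) ν
      (fun (_ : ℝ) (_ : UnitAddTorus (Fin 2)) => (0 : EuclideanSpace ℝ (Fin 2)))
      (fun (_ : ℝ) (_ : UnitAddTorus (Fin 2)) => (0 : EuclideanSpace ℝ (Fin 2)))
      (fun (_ : ℝ) (_ : UnitAddTorus (Fin 2)) => (0 : ℝ)) :=
    fun _ => isClassicalNSSolutionOn_rest_on (Ici 0) ν
  have hE : ∀ (j : ℕ) (t : ℝ), 0 ≤ t →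
      ∫ _x : UnitAddTorus (Fin 2), ‖(0 : EuclideanSpace ℝ (Fin 2))‖ ^ 2 ≤ (0 : ℝ) := by
    intro _ _ _
    simp
  -- the heat releases
  have hRel : ∀ (j : ℕ) (s : ℝ), 0 ≤ s →
      Torus.IsClassicalScalarTransportOn (Set.Ici s) ν
        (fun (_ : ℝ) (_ : UnitAddTorus (Fin 2)) => (0 : EuclideanSpace ℝ (Fin 2)))
        (fun t => cosMode k₁ (Real.exp (-(ν * lam k₁) * (t - s)))) ∧
      cosMode k₁ (Real.exp (-(ν * lam k₁) * (s - s))) = cosMode k₁ 1 := by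
    intro _ s _
    refine ⟨isClassicalScalarTransportOn_heatRelease k₁ ν s, ?_⟩
    rw [sub_self, mul_zero, Real.exp_zero]
  -- (MS): an identity, `‖φ_j s (s+τ)‖² = e^{-2cτ}/2` for every `s`
  have hMS : ∀ (j : ℕ) (τ T : ℝ), 0 ≤ τ → (0 : ℝ) ≤ T →
      ∫ s in (0 : ℝ)..T, Torus.scalarL2Sq (cosMode k₁ (Real.exp (-(ν * lam k₁) * (s + τ - s)))) ≤
        (0 + (T - 0)) * Real.exp (-(ν * lam k₁) * τ) ^ 2 * Torus.scalarL2Sq (cosMode k₁ 1) := by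
    intro _ τ T _ _
    have hred : ∀ s : ℝ, Torus.scalarL2Sq (cosMode k₁ (Real.exp (-(ν * lam k₁) * (s + τ - s)))) =
        Real.exp (-(ν * lam k₁) * τ) ^ 2 / 2 := fun s => by
      rw [add_sub_cancel_left, scalarL2Sq_cosMode k₁_ne_zero]
    simp_rw [hred]
    rw [intervalIntegral.integral_const, smul_eq_mul, scalarL2Sq_cosMode k₁_ne_zero]
    apply le_of_eq
    ring
  -- (GK): the Cesàro means of `t ↦ (1 - e^{-ct})/(2c)` converge to `1/(2c)`
  have hGK : ∀ j : ℕ, 1 / (2 * (ν * lam k₁)) ≤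
      liminf (timeMean fun t => ∫ s in (0 : ℝ)..t, ∫ x,
        cosMode k₁ 1 x * cosMode k₁ (Real.exp (-(ν * lam k₁) * (t - s))) x) atTop := by
    intro _
    have hfun : (fun t => ∫ s in (0 : ℝ)..t, ∫ x,
        cosMode k₁ 1 x * cosMode k₁ (Real.exp (-(ν * lam k₁) * (t - s))) x) =
        fun t => (1 - Real.exp (-(ν * lam k₁) * t)) / (2 * (ν * lam k₁)) :=
      funext fun t => heatRelease_gk_integral_eq hc.ne' t
    rw [hfun]
    exact (tendsto_timeMean_heatRate_gk hc).liminf_eq.ge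
  exact ⟨fun _ => 0, cosMode k₁ 1, isSmooth_const _, fun x => divergence_zero x, by simp [HasZeroMean],
    isSmooth_cosMode k₁ 1, hasZeroMean_cosMode k₁_ne_zero 1, hh0, fun _ _ _ => 0, fun _ _ _ => 0,
    fun _ s t => cosMode k₁ (Real.exp (-(ν * lam k₁) * (t - s))), fun τ => Real.exp (-(ν * lam k₁) * τ),
    0, 0, 0, 1 / (ν * lam k₁), 1 / (2 * (ν * lam k₁)), hNS, hE, hRel, le_rfl, le_rfl,
    heatRate_antitone hc.le, fun τ => Real.exp_pos _, fun t _ => heatRate_integral_le hc t, hMS,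
    by positivity, hGK⟩

end Summit.AnomalousDissipation.AnomalousDissipation.Theorems.ScalarAnomalySteadySourceFormal.MeanSquareBodyFixedViscosity

end
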